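import Literature.AnabelianGeometry.AbsoluteAnabelian.MLFGaloisElasticProofs
import Literature.AnabelianGeometry.AbsoluteAnabelian.ProfiniteElasticOpenSubgroups
import Literature.AnabelianGeometry.AbsoluteAnabelian.AbsTopIChainsRemark422
import Literature.AnabelianGeometry.AbsoluteAnabelian.AbsTopIProp410GraphSurjectivityPrelims
import Literature.AnabelianGeometry.AbsoluteAnabelian.GaloisSubextensionProofs
import Literature.AnabelianGeometry.AbsoluteAnabelian.SubpadicExamples
import Literature.AnabelianGeometry.AbsoluteAnabelian.SubpadicSlimProofs
import Literature.AnabelianGeometry.SemiGraphs.TemperedAnabelian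
import Mathlib.GroupTheory.Nilpotent
import HarnessLib

/-!
# Slim and elastic groups have no non-trivial topologically finitely generated closed normal
# subgroup with a non-trivial centre — in particular `G_K` (`K/ℚ_p` finite) has no non-trivial
# tfg closed normal abelian / nilpotent subgroup, and neither has any open subgroup of `G_K`

S. Mochizuki, *Topics in Absolute Anabelian Geometry I: Generalities*, J. Math. Sci. Univ. Tokyo **19**
(2012) [AbsTopI], Def. 1.1 (ii) p. 10 (elastic), §0 p. 8 (slim), Thm. 1.7 (ii) p. 14 («If `k` is an MLF, then
`G_k` … is elastic»), and the PROOF of Thm. 2.6 (iv) p. 24 («Assertion (iv) follows immediately from the existence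
of a surjection `G ↠ Ẑ`, together with the elasticity of `G` [cf. Theorem 1.7, (ii)], and the topological finite
generation of `Δ`» — i.e., unquoted paraphrase of the elasticity argument implicit there: the image of such an `N`
in `G` is a topologically finitely generated closed normal subgroup, hence by elasticity trivial or of finite
index). [cite: MochizukiAbsTopI2012, Thm 1.7 (ii) p.14]

PROOF-ONLY file (no `def`, no `instance`, no notation, no new named fact) over the tree's typed [AbsTopI]
predicates `IsElastic`, `IsSlimGroup`, `IsTopologicallyFinitelyGenerated`.  Cell abc-iut, seat abc-iut-f-153
(gen 8): BY-NAME supply for the K-L6 row «COR219III-M1b (β)» of abc-iut-w5-d187 (residual (G), STATUS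
2026-08-27T02:58:44Z: «Δ-stability of an arbitrary admissible γ ⟸ … ⟸ G_K has no non-trivial closed normal
nilpotent subgroup»): for TOPOLOGICALLY FINITELY GENERATED subgroups that classical input is a consequence of
two theorems ALREADY in the tree — `isElastic_absoluteGaloisGroup` ([AbsTopI] Thm 1.7 (ii)) and
`IsSubpadicFor.isSlimGroup_absoluteGaloisGroup` ([pGC] Lem 15.8) — by the argument of the proof of [AbsTopI]
Thm 2.6 (iv) with «almost pro-omissive» replaced by «non-trivial centre» + slimness:

* §1 `eq_bot_of_isSlimGroup_of_isElastic` — `G` slim and elastic, `H ⊆ G` open, `N ⊆ H` closed, normal in `H`,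
  topologically finitely generated, and possessing a non-trivial element commuting with `N` whenever `N ≠ 1`
  ⇒ `N = 1` (elasticity: `N = 1` or `[G : N] < ∞`; a closed finite-index subgroup is open, and an element of
  `G` centralising an open subgroup is trivial by slimness); corollaries for `N` abelian
  (`…_of_comm`), nilpotent of class `≤ 2` (`…_of_classTwo`, the Heisenberg shape `⁅⁅x,y⁆,z⁆ = 1`) and
  Mathlib-nilpotent (`…_of_isNilpotent`).
* §2 IMAGE FORM for a continuous surjection `f : Π ↠ G` from an ARBITRARY topological group (the tempered
  `Π^tp_X̲̲` of [EtTh] is not compact): a normal, topologically finitely generated subgroup `N ◁ Π` whose IMAGE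
  is abelian, resp. of class `≤ 2` (`f ⁅⁅x,y⁆,z⁆ = 1` on `N` — e.g. `N/K₀` class `≤ 2` for some `K₀ ⊆ Ker f`),
  lies in `Ker f` (`le_ker_of_isSlimGroup_of_isElastic_of_comm` / `…_of_classTwo`) — the closure of `f(N)`
  in `G` is closed, normal, tfg and still abelian / of class `≤ 2`.
* §3 INSTANCES BY NAME: `G_K` for `K/ℚ_p` finite (`absoluteGaloisGroup_…`), its open subgroups
  (`isSlimGroup_isElastic_of_isOpen_absoluteGaloisGroup`), and `GQp p` of the [EtTh]/[SemiAnbd] models.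

HONEST FRAMING: classical profinite group theory; [AbsTopI] is a refereed, published paper typed
statements-first — «establishment» here is OUR kernel check of the typed predicates; nothing of [EtTh] or
[IUTchIII] is asserted; no side taken on [IUTchIII] Cor. 3.12; typed ≠ proved.
-/

noncomputable section

open Topology
open scoped commutatorElement

universe u v

namespace Literature.AnabelianGeometry.AbsoluteAnabelian

open Literature.AlgebraicGeometry.Frobenioids (IsSlimGroup)

/-! ## §1. Slim + elastic ⇒ no non-trivial tfg closed normal subgroup with a non-trivial centre -/

section Generic

variable {G : Type u} [Group G] [TopologicalSpace G] [IsTopologicalGroup G]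

omit [IsTopologicalGroup G] in
/-- In a slim group an element commuting with every element of an OPEN subgroup is trivial
([AbsTopI] §0 «slim»: the centraliser of any open subgroup is trivial).
[cite: MochizukiAbsTopI2012, §0 p.8] -/
theorem eq_one_of_isSlimGroup_of_forall_mem_comm (hG : IsSlimGroup G) (U : Subgroup G)
    (hU : IsOpen (U : Set G)) {z : G} (hz : ∀ u ∈ U, u * z = z * u) : z = 1 := by
  have hmem : z ∈ Subgroup.centralizer (U : Set G) := Subgroup.mem_centralizer_iff.mpr hz
  rw [hG.centralizer_eq_bot U hU] at hmem
  exact Subgroup.mem_bot.mp hmem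

/-- **Slim + elastic ⇒ no non-trivial topologically finitely generated closed normal subgroup with a
non-trivial centre.**  Let `G` be slim and elastic, `H ⊆ G` open, `N ⊆ H` closed in `G`, normal in `H`,
topologically finitely generated, and such that whenever `N ≠ 1` some `z ∈ N`, `z ≠ 1`, commutes with
all of `N`.  Then `N = 1`: by elasticity ([AbsTopI] Def 1.1 (ii)) `N = 1` or `[G : N] < ∞`; in the
latter case `N` is open (closed of finite index), and `z` centralises the open subgroup `N`, so `z = 1`
by slimness — the argument of the proof of [AbsTopI] Thm 2.6 (iv) p. 24 with «almost pro-omissive»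
replaced by «non-trivial centre». [cite: MochizukiAbsTopI2012, Thm 2.6 (iv) p.24] -/
theorem eq_bot_of_isSlimGroup_of_isElastic (hGs : IsSlimGroup G) (hGe : IsElastic G)
    (H N : Subgroup G) (hHo : IsOpen (H : Set G)) (hNH : N ≤ H) (hNn : (N.subgroupOf H).Normal)
    (hNc : IsClosed (N : Set G)) (hNfg : IsTopologicallyFinitelyGenerated N)
    (hz : N ≠ ⊥ → ∃ z ∈ N, z ≠ 1 ∧ ∀ n ∈ N, n * z = z * n) : N = ⊥ := by
  rcases hGe.eq_bot_or_finiteIndex H N hHo hNH hNn hNc hNfg with h | h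
  · exact h
  · by_contra hne
    haveI := h
    have hNo : IsOpen (N : Set G) := Subgroup.isOpen_of_isClosed_of_finiteIndex N hNc
    obtain ⟨z, -, hz1, hzc⟩ := hz hne
    exact hz1 (eq_one_of_isSlimGroup_of_forall_mem_comm hGs N hNo hzc)

/-- The case `H = G`: a closed, NORMAL, topologically finitely generated subgroup of a slim elastic
group with a non-trivial central element whenever non-trivial is trivial.
[cite: MochizukiAbsTopI2012, Thm 2.6 (iv) p.24] -/
theorem eq_bot_of_isSlimGroup_of_isElastic_of_normal (hGs : IsSlimGroup G) (hGe : IsElastic G)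
    (N : Subgroup G) [hN : N.Normal] (hNc : IsClosed (N : Set G))
    (hNfg : IsTopologicallyFinitelyGenerated N)
    (hz : N ≠ ⊥ → ∃ z ∈ N, z ≠ 1 ∧ ∀ n ∈ N, n * z = z * n) : N = ⊥ :=
  eq_bot_of_isSlimGroup_of_isElastic hGs hGe ⊤ N (by rw [Subgroup.coe_top]; exact isOpen_univ)
    le_top (hN.subgroupOf ⊤) hNc hNfg hz

/-- **No non-trivial tfg closed normal ABELIAN subgroup** in a slim elastic group.
[cite: MochizukiAbsTopI2012, Thm 2.6 (iv) p.24] -/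
theorem eq_bot_of_isSlimGroup_of_isElastic_of_comm (hGs : IsSlimGroup G) (hGe : IsElastic G)
    (N : Subgroup G) [N.Normal] (hNc : IsClosed (N : Set G))
    (hNfg : IsTopologicallyFinitelyGenerated N) (hcomm : ∀ x ∈ N, ∀ y ∈ N, x * y = y * x) :
    N = ⊥ := by
  refine eq_bot_of_isSlimGroup_of_isElastic_of_normal hGs hGe N hNc hNfg fun hne => ?_
  obtain ⟨z, hzN, hz1⟩ : ∃ z ∈ N, z ≠ 1 := by
    by_contra h
    push Not at h
    exact hne ((Subgroup.eq_bot_iff_forall N).mpr h)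
  exact ⟨z, hzN, hz1, fun n hn => hcomm n hn z hzN⟩

/-- **No non-trivial tfg closed normal subgroup NILPOTENT OF CLASS `≤ 2`** (`⁅⁅x,y⁆,z⁆ = 1` on `N` — the
shape of the Heisenberg-type quotients `Δ^Θ` of [EtTh] §1) in a slim elastic group: either `N` is
abelian, or some commutator `⁅x,y⁆ ≠ 1` of `N` is central in `N`.
[cite: MochizukiAbsTopI2012, Thm 2.6 (iv) p.24] -/
theorem eq_bot_of_isSlimGroup_of_isElastic_of_classTwo (hGs : IsSlimGroup G) (hGe : IsElastic G)
    (N : Subgroup G) [N.Normal] (hNc : IsClosed (N : Set G))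
    (hNfg : IsTopologicallyFinitelyGenerated N)
    (h2 : ∀ x ∈ N, ∀ y ∈ N, ∀ z ∈ N, ⁅⁅x, y⁆, z⁆ = 1) : N = ⊥ := by
  refine eq_bot_of_isSlimGroup_of_isElastic_of_normal hGs hGe N hNc hNfg fun hne => ?_
  by_cases hab : ∀ x ∈ N, ∀ y ∈ N, x * y = y * x
  · obtain ⟨z, hzN, hz1⟩ : ∃ z ∈ N, z ≠ 1 := by
      by_contra h
      push Not at h
      exact hne ((Subgroup.eq_bot_iff_forall N).mpr h)
    exact ⟨z, hzN, hz1, fun n hn => hab n hn z hzN⟩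
  · push Not at hab
    obtain ⟨x, hx, y, hy, hxy⟩ := hab
    refine ⟨⁅x, y⁆, ?_, fun h1 => hxy (commutatorElement_eq_one_iff_mul_comm.mp h1), fun n hn => ?_⟩
    · rw [commutatorElement_def]
      exact N.mul_mem (N.mul_mem (N.mul_mem hx hy) (N.inv_mem hx)) (N.inv_mem hy)
    · exact (commutatorElement_eq_one_iff_mul_comm.mp (h2 x hx y hy n hn)).symm

/-- **No non-trivial tfg closed normal NILPOTENT subgroup** (Mathlib's `Group.IsNilpotent` on the subgroup
type) in a slim elastic group: a non-trivial nilpotent group has a non-trivial centre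
(`Group.IsNilpotent.center_ne_bot`). [cite: MochizukiAbsTopI2012, Thm 2.6 (iv) p.24] -/
theorem eq_bot_of_isSlimGroup_of_isElastic_of_isNilpotent (hGs : IsSlimGroup G) (hGe : IsElastic G)
    (N : Subgroup G) [N.Normal] (hNc : IsClosed (N : Set G))
    (hNfg : IsTopologicallyFinitelyGenerated N) [Group.IsNilpotent N] : N = ⊥ := by
  refine eq_bot_of_isSlimGroup_of_isElastic_of_normal hGs hGe N hNc hNfg fun hne => ?_
  haveI : Nontrivial N := by
    obtain ⟨z, hzN, hz1⟩ : ∃ z ∈ N, z ≠ 1 := by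
      by_contra h
      push Not at h
      exact hne ((Subgroup.eq_bot_iff_forall N).mpr h)
    exact ⟨⟨⟨z, hzN⟩, 1, fun h => hz1 (congrArg Subtype.val h)⟩⟩
  have hc : Subgroup.center N ≠ ⊥ := Group.IsNilpotent.center_ne_bot (G := N)
  obtain ⟨z, hzc, hz1⟩ : ∃ z ∈ Subgroup.center N, z ≠ 1 := by
    by_contra h
    push Not at h
    exact hc ((Subgroup.eq_bot_iff_forall _).mpr h)
  refine ⟨(z : G), z.2, fun h => hz1 (Subtype.ext h), fun n hn => ?_⟩
  have := Subgroup.mem_center_iff.mp hzc ⟨n, hn⟩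
  exact congrArg Subtype.val this

end Generic

/-! ## §2. Image form: tfg normal abelian / class-`≤ 2` subgroups map into the kernel of any continuous
surjection onto a slim elastic group -/

section Image

variable {P : Type v} [Group P] [TopologicalSpace P] [IsTopologicalGroup P]
variable {G : Type u} [Group G] [TopologicalSpace G] [IsTopologicalGroup G] [T2Space G]

/-- Commutativity passes to the topological closure of a subgroup (Hausdorff ambient group).
[cite: MochizukiAbsTopI2012, §0 p.8] -/
theorem comm_of_mem_topologicalClosure (K : Subgroup G) (hK : ∀ x ∈ K, ∀ y ∈ K, x * y = y * x) :
    ∀ x ∈ K.topologicalClosure, ∀ y ∈ K.topologicalClosure, x * y = y * x := by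
  have hmem : ∀ {x : G}, x ∈ K.topologicalClosure → x ∈ closure (K : Set G) := fun hx => by
    rw [← Subgroup.topologicalClosure_coe]; exact hx
  have step1 : ∀ y ∈ K, ∀ x ∈ K.topologicalClosure, x * y = y * x := by
    intro y hy x hx
    have hcl : IsClosed {x : G | x * y = y * x} :=
      isClosed_eq (continuous_id.mul continuous_const) (continuous_const.mul continuous_id)
    have hsub : (K : Set G) ⊆ {x : G | x * y = y * x} := fun x hx => hK x hx y hy
    exact (hcl.closure_subset_iff.mpr hsub) (hmem hx)
  intro x hx y hy
  have hcl : IsClosed {y : G | x * y = y * x} :=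
    isClosed_eq (continuous_const.mul continuous_id) (continuous_id.mul continuous_const)
  have hsub : (K : Set G) ⊆ {y : G | x * y = y * x} := fun y hy' => step1 y hy' x hx
  exact (hcl.closure_subset_iff.mpr hsub) (hmem hy)

/-- The class-`≤ 2` law `⁅⁅x,y⁆,z⁆ = 1` passes to the topological closure of a subgroup (Hausdorff
ambient group). [cite: MochizukiAbsTopI2012, §0 p.8] -/
theorem classTwo_of_mem_topologicalClosure (K : Subgroup G)
    (hK : ∀ x ∈ K, ∀ y ∈ K, ∀ z ∈ K, ⁅⁅x, y⁆, z⁆ = 1) :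
    ∀ x ∈ K.topologicalClosure, ∀ y ∈ K.topologicalClosure, ∀ z ∈ K.topologicalClosure,
      ⁅⁅x, y⁆, z⁆ = 1 := by
  have hmem : ∀ {x : G}, x ∈ K.topologicalClosure → x ∈ closure (K : Set G) := fun hx => by
    rw [← Subgroup.topologicalClosure_coe]; exact hx
  have hc1 : ∀ y z : G, Continuous fun x : G => ⁅⁅x, y⁆, z⁆ := fun y z => by
    simp only [commutatorElement_def]; fun_prop
  have hc2 : ∀ x z : G, Continuous fun y : G => ⁅⁅x, y⁆, z⁆ := fun x z => by
    simp only [commutatorElement_def]; fun_prop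
  have hc3 : ∀ x y : G, Continuous fun z : G => ⁅⁅x, y⁆, z⁆ := fun x y => by
    simp only [commutatorElement_def]; fun_prop
  have s1 : ∀ y ∈ K, ∀ z ∈ K, ∀ x ∈ K.topologicalClosure, ⁅⁅x, y⁆, z⁆ = 1 := by
    intro y hy z hz x hx
    have hcl : IsClosed {x : G | ⁅⁅x, y⁆, z⁆ = 1} := isClosed_eq (hc1 y z) continuous_const
    have hsub : (K : Set G) ⊆ {x : G | ⁅⁅x, y⁆, z⁆ = 1} := fun x hx => hK x hx y hy z hz
    exact (hcl.closure_subset_iff.mpr hsub) (hmem hx)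
  have s2 : ∀ z ∈ K, ∀ x ∈ K.topologicalClosure, ∀ y ∈ K.topologicalClosure, ⁅⁅x, y⁆, z⁆ = 1 := by
    intro z hz x hx y hy
    have hcl : IsClosed {y : G | ⁅⁅x, y⁆, z⁆ = 1} := isClosed_eq (hc2 x z) continuous_const
    have hsub : (K : Set G) ⊆ {y : G | ⁅⁅x, y⁆, z⁆ = 1} := fun y hy' => s1 y hy' z hz x hx
    exact (hcl.closure_subset_iff.mpr hsub) (hmem hy)
  intro x hx y hy z hz
  have hcl : IsClosed {z : G | ⁅⁅x, y⁆, z⁆ = 1} := isClosed_eq (hc3 x y) continuous_const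
  have hsub : (K : Set G) ⊆ {z : G | ⁅⁅x, y⁆, z⁆ = 1} := fun z hz' => s2 z hz' x hx y hy
  exact (hcl.closure_subset_iff.mpr hsub) (hmem hz)

omit [T2Space G] in
/-- The topological closure of the image of a topologically finitely generated subgroup under a
continuous homomorphism is topologically finitely generated. [cite: MochizukiAbsTopI2012, §0 p.8] -/
theorem isTopologicallyFinitelyGenerated_topologicalClosure_map (f : P →* G) (hf : Continuous f)
    (N : Subgroup P) (hNfg : IsTopologicallyFinitelyGenerated N) :
    IsTopologicallyFinitelyGenerated (N.map f).topologicalClosure := by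
  let φ : N →ₜ* (N.map f).topologicalClosure :=
    ⟨{ toFun := fun x => ⟨f x, Subgroup.le_topologicalClosure _ ⟨x, x.2, rfl⟩⟩
       map_one' := by ext; simp
       map_mul' := fun x y => by ext; simp },
      by
        apply Continuous.subtype_mk
        exact hf.comp continuous_subtype_val⟩
  have hφ : DenseRange φ := by
    rw [DenseRange, Subtype.dense_iff]
    intro g hg
    have hg' : g ∈ closure ((N.map f : Subgroup G) : Set G) := by
      rw [← Subgroup.topologicalClosure_coe]; exact hg
    refine closure_mono ?_ hg'
    rintro _ ⟨x, hx, rfl⟩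
    exact ⟨⟨f x, Subgroup.le_topologicalClosure _ ⟨x, hx, rfl⟩⟩, ⟨⟨x, hx⟩, rfl⟩, rfl⟩
  exact hNfg.of_denseRange φ hφ

/-- **IMAGE FORM, abelian case.**  Let `f : Π → G` be a continuous surjective homomorphism onto a
Hausdorff slim elastic group and `N ◁ Π` a normal, topologically finitely generated subgroup WITH ABELIAN
IMAGE (`f x · f y = f y · f x` on `N`; no compactness of `Π` required — e.g. the tempered `Π^tp` of
[EtTh]).  Then `N ⊆ Ker f`: the closure `M` of `f(N)` is a closed, normal (`f` onto), topologically
finitely generated, abelian subgroup of `G`, hence trivial by §1. [cite: MochizukiAbsTopI2012, Thm 2.6 (iv) p.24] -/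
theorem le_ker_of_isSlimGroup_of_isElastic_of_comm (hGs : IsSlimGroup G) (hGe : IsElastic G)
    (f : P →* G) (hf : Continuous f) (hfs : Function.Surjective f)
    (N : Subgroup P) [hN : N.Normal] (hNfg : IsTopologicallyFinitelyGenerated N)
    (hcomm : ∀ x ∈ N, ∀ y ∈ N, f x * f y = f y * f x) : N ≤ f.ker := by
  haveI : (N.map f).Normal := hN.map f hfs
  haveI : (N.map f).topologicalClosure.Normal := Subgroup.is_normal_topologicalClosure _
  have hM : (N.map f).topologicalClosure = ⊥ :=
    eq_bot_of_isSlimGroup_of_isElastic_of_comm hGs hGe _ (Subgroup.isClosed_topologicalClosure _)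
      (isTopologicallyFinitelyGenerated_topologicalClosure_map f hf N hNfg)
      (comm_of_mem_topologicalClosure _ (by
        rintro _ ⟨x, hx, rfl⟩ _ ⟨y, hy, rfl⟩
        exact hcomm x hx y hy))
  intro x hx
  rw [MonoidHom.mem_ker]
  have : f x ∈ (N.map f).topologicalClosure := Subgroup.le_topologicalClosure _ ⟨x, hx, rfl⟩
  rw [hM] at this
  exact Subgroup.mem_bot.mp this

/-- **IMAGE FORM, class-`≤ 2` case** (`f ⁅⁅x,y⁆,z⁆ = 1` on `N`: the IMAGE satisfies the Heisenberg-shape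
law — e.g. `N ⊇ K₀ ⊆ Ker f` with `N/K₀ ≅ Δ^Θ` a theta quotient of [EtTh] §1): for a continuous surjective
homomorphism `f : Π → G` onto a Hausdorff slim elastic group, every normal topologically finitely generated
subgroup `N ◁ Π` whose image is nilpotent of class `≤ 2` lies in `Ker f`.
[cite: MochizukiAbsTopI2012, Thm 2.6 (iv) p.24] -/
theorem le_ker_of_isSlimGroup_of_isElastic_of_classTwo (hGs : IsSlimGroup G) (hGe : IsElastic G)
    (f : P →* G) (hf : Continuous f) (hfs : Function.Surjective f)
    (N : Subgroup P) [hN : N.Normal] (hNfg : IsTopologicallyFinitelyGenerated N)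
    (h2 : ∀ x ∈ N, ∀ y ∈ N, ∀ z ∈ N, f ⁅⁅x, y⁆, z⁆ = 1) : N ≤ f.ker := by
  haveI : (N.map f).Normal := hN.map f hfs
  haveI : (N.map f).topologicalClosure.Normal := Subgroup.is_normal_topologicalClosure _
  have hM : (N.map f).topologicalClosure = ⊥ :=
    eq_bot_of_isSlimGroup_of_isElastic_of_classTwo hGs hGe _ (Subgroup.isClosed_topologicalClosure _)
      (isTopologicallyFinitelyGenerated_topologicalClosure_map f hf N hNfg)
      (classTwo_of_mem_topologicalClosure _ (by
        rintro _ ⟨x, hx, rfl⟩ _ ⟨y, hy, rfl⟩ _ ⟨z, hz, rfl⟩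
        rw [← map_commutatorElement, ← map_commutatorElement, h2 x hx y hy z hz]))
  intro x hx
  rw [MonoidHom.mem_ker]
  have : f x ∈ (N.map f).topologicalClosure := Subgroup.le_topologicalClosure _ ⟨x, hx, rfl⟩
  rw [hM] at this
  exact Subgroup.mem_bot.mp this

end Image

/-! ## §3. Instances: `G_K` (`K/ℚ_p` finite), its open subgroups, and `GQp p` -/

section Instances

open Field

/-- `G_K` is slim AND elastic for `K/ℚ_p` finite ([pGC] Lem 15.8 via `IsSubpadicFor`, [AbsTopI] Thm 1.7 (ii)).
[cite: MochizukiAbsTopI2012, Thm 1.7 (ii) p.14] -/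
theorem isSlimGroup_isElastic_absoluteGaloisGroup (p : ℕ) [Fact p.Prime] (K : Type) [Field K]
    [Algebra ℚ_[p] K] [FiniteDimensional ℚ_[p] K] :
    IsSlimGroup (absoluteGaloisGroup K) ∧ IsElastic (absoluteGaloisGroup K) :=
  ⟨IsSubpadicFor.isSlimGroup_absoluteGaloisGroup ((AbsTopIII.IsSubpadicFor.padic p).of_finite (F := K)),
    isElastic_absoluteGaloisGroup p K⟩

/-- Every OPEN subgroup of `G_K` (`K/ℚ_p` finite) is slim and elastic.
[cite: MochizukiAbsTopI2012, Thm 1.7 (ii) p.14] -/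
theorem isSlimGroup_isElastic_of_isOpen_absoluteGaloisGroup (p : ℕ) [Fact p.Prime] (K : Type) [Field K]
    [Algebra ℚ_[p] K] [FiniteDimensional ℚ_[p] K] (U : Subgroup (absoluteGaloisGroup K))
    (hU : IsOpen (U : Set (absoluteGaloisGroup K))) : IsSlimGroup U ∧ IsElastic U :=
  ⟨(isSlimGroup_isElastic_absoluteGaloisGroup p K).1.subgroup_of_isOpen U hU,
    (isSlimGroup_isElastic_absoluteGaloisGroup p K).2.subgroup_of_isOpen U hU⟩

/-- **`G_K` (`K/ℚ_p` finite) has no non-trivial topologically finitely generated closed normal subgroup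
of any open subgroup `H` with a non-trivial central element** — e.g. abelian or nilpotent.
[cite: MochizukiAbsTopI2012, Thm 1.7 (ii) p.14] -/
theorem absoluteGaloisGroup_eq_bot_of_tfg_of_center (p : ℕ) [Fact p.Prime] (K : Type) [Field K]
    [Algebra ℚ_[p] K] [FiniteDimensional ℚ_[p] K] (H N : Subgroup (absoluteGaloisGroup K))
    (hHo : IsOpen (H : Set (absoluteGaloisGroup K))) (hNH : N ≤ H) (hNn : (N.subgroupOf H).Normal)
    (hNc : IsClosed (N : Set (absoluteGaloisGroup K))) (hNfg : IsTopologicallyFinitelyGenerated N)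
    (hz : N ≠ ⊥ → ∃ z ∈ N, z ≠ 1 ∧ ∀ n ∈ N, n * z = z * n) : N = ⊥ :=
  eq_bot_of_isSlimGroup_of_isElastic (isSlimGroup_isElastic_absoluteGaloisGroup p K).1
    (isSlimGroup_isElastic_absoluteGaloisGroup p K).2 H N hHo hNH hNn hNc hNfg hz

/-- `G_K` (`K/ℚ_p` finite) has no non-trivial tfg closed normal ABELIAN subgroup.
[cite: MochizukiAbsTopI2012, Thm 1.7 (ii) p.14] -/
theorem absoluteGaloisGroup_eq_bot_of_tfg_of_comm (p : ℕ) [Fact p.Prime] (K : Type) [Field K]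
    [Algebra ℚ_[p] K] [FiniteDimensional ℚ_[p] K] (N : Subgroup (absoluteGaloisGroup K)) [N.Normal]
    (hNc : IsClosed (N : Set (absoluteGaloisGroup K))) (hNfg : IsTopologicallyFinitelyGenerated N)
    (hcomm : ∀ x ∈ N, ∀ y ∈ N, x * y = y * x) : N = ⊥ :=
  eq_bot_of_isSlimGroup_of_isElastic_of_comm (isSlimGroup_isElastic_absoluteGaloisGroup p K).1
    (isSlimGroup_isElastic_absoluteGaloisGroup p K).2 N hNc hNfg hcomm

/-- `G_K` (`K/ℚ_p` finite) has no non-trivial tfg closed normal NILPOTENT subgroup.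
[cite: MochizukiAbsTopI2012, Thm 1.7 (ii) p.14] -/
theorem absoluteGaloisGroup_eq_bot_of_tfg_of_isNilpotent (p : ℕ) [Fact p.Prime] (K : Type) [Field K]
    [Algebra ℚ_[p] K] [FiniteDimensional ℚ_[p] K]
    (N : Subgroup (absoluteGaloisGroup K)) [N.Normal]
    (hNc : IsClosed (N : Set (absoluteGaloisGroup K))) (hNfg : IsTopologicallyFinitelyGenerated N)
    [Group.IsNilpotent N] : N = ⊥ :=
  eq_bot_of_isSlimGroup_of_isElastic_of_isNilpotent (isSlimGroup_isElastic_absoluteGaloisGroup p K).1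
    (isSlimGroup_isElastic_absoluteGaloisGroup p K).2 N hNc hNfg

variable {P : Type v} [Group P] [TopologicalSpace P] [IsTopologicalGroup P]

/-- **Image form at `G_K`**: for a continuous surjection `f : Π ↠ G_K` (`K/ℚ_p` finite) from any
topological group, a normal tfg subgroup `N ◁ Π` whose IMAGE is nilpotent of class `≤ 2` lies in `Ker f`.
[cite: MochizukiAbsTopI2012, Thm 2.6 (iv) p.24] -/
theorem le_ker_absoluteGaloisGroup_of_classTwo (p : ℕ) [Fact p.Prime] (K : Type) [Field K]
    [Algebra ℚ_[p] K] [FiniteDimensional ℚ_[p] K] (f : P →* absoluteGaloisGroup K) (hf : Continuous f)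
    (hfs : Function.Surjective f) (N : Subgroup P) [N.Normal] (hNfg : IsTopologicallyFinitelyGenerated N)
    (h2 : ∀ x ∈ N, ∀ y ∈ N, ∀ z ∈ N, f ⁅⁅x, y⁆, z⁆ = 1) : N ≤ f.ker := by
  haveI : T2Space (absoluteGaloisGroup K) := krullTopology_t2
  exact le_ker_of_isSlimGroup_of_isElastic_of_classTwo (isSlimGroup_isElastic_absoluteGaloisGroup p K).1
    (isSlimGroup_isElastic_absoluteGaloisGroup p K).2 f hf hfs N hNfg h2

/-- **Image form at `G_K`, abelian case.** [cite: MochizukiAbsTopI2012, Thm 2.6 (iv) p.24] -/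
theorem le_ker_absoluteGaloisGroup_of_comm (p : ℕ) [Fact p.Prime] (K : Type) [Field K]
    [Algebra ℚ_[p] K] [FiniteDimensional ℚ_[p] K] (f : P →* absoluteGaloisGroup K) (hf : Continuous f)
    (hfs : Function.Surjective f) (N : Subgroup P) [N.Normal] (hNfg : IsTopologicallyFinitelyGenerated N)
    (hcomm : ∀ x ∈ N, ∀ y ∈ N, f x * f y = f y * f x) : N ≤ f.ker := by
  haveI : T2Space (absoluteGaloisGroup K) := krullTopology_t2
  exact le_ker_of_isSlimGroup_of_isElastic_of_comm (isSlimGroup_isElastic_absoluteGaloisGroup p K).1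
    (isSlimGroup_isElastic_absoluteGaloisGroup p K).2 f hf hfs N hNfg hcomm

/-! ### At `GQp p` (`= G_{ℚ_p}`, the arithmetic factor of the [SemiAnbd]/[EtTh] models) -/

/-- `G_{ℚ_p}` (the cell's `GQp p`) is slim and elastic. [cite: MochizukiAbsTopI2012, Thm 1.7 (ii) p.14] -/
theorem isSlimGroup_isElastic_GQp (p : ℕ) [Fact p.Prime] : IsSlimGroup (SemiGraphs.GQp p) ∧ IsElastic (SemiGraphs.GQp p) :=
  isSlimGroup_isElastic_absoluteGaloisGroup p ℚ_[p]

/-- **Image form at `GQp p`, class-`≤ 2` case**: for a continuous surjection `f : Π ↠ G_{ℚ_p}` from any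
topological group (e.g. the augmentation of a tempered `Π^tp_X̲̲ = Δ ⋊ G_{ℚ_p}`), every normal,
topologically finitely generated subgroup `N ◁ Π` with `f ⁅⁅x,y⁆,z⁆ = 1` on `N` lies in `Ker f`.
[cite: MochizukiAbsTopI2012, Thm 2.6 (iv) p.24] -/
theorem le_ker_GQp_of_classTwo (p : ℕ) [Fact p.Prime] (f : P →* SemiGraphs.GQp p) (hf : Continuous f)
    (hfs : Function.Surjective f) (N : Subgroup P) [N.Normal] (hNfg : IsTopologicallyFinitelyGenerated N)
    (h2 : ∀ x ∈ N, ∀ y ∈ N, ∀ z ∈ N, f ⁅⁅x, y⁆, z⁆ = 1) : N ≤ f.ker :=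
  le_ker_absoluteGaloisGroup_of_classTwo p ℚ_[p] f hf hfs N hNfg h2

/-- **Image form at `GQp p`, abelian case.** [cite: MochizukiAbsTopI2012, Thm 2.6 (iv) p.24] -/
theorem le_ker_GQp_of_comm (p : ℕ) [Fact p.Prime] (f : P →* SemiGraphs.GQp p) (hf : Continuous f)
    (hfs : Function.Surjective f) (N : Subgroup P) [N.Normal] (hNfg : IsTopologicallyFinitelyGenerated N)
    (hcomm : ∀ x ∈ N, ∀ y ∈ N, f x * f y = f y * f x) : N ≤ f.ker :=
  le_ker_absoluteGaloisGroup_of_comm p ℚ_[p] f hf hfs N hNfg hcomm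

/-- `G_{ℚ_p}` has no non-trivial tfg closed normal subgroup of any open subgroup with a non-trivial
central element. [cite: MochizukiAbsTopI2012, Thm 1.7 (ii) p.14] -/
theorem GQp_eq_bot_of_tfg_of_center (p : ℕ) [Fact p.Prime] (H N : Subgroup (SemiGraphs.GQp p))
    (hHo : IsOpen (H : Set (SemiGraphs.GQp p))) (hNH : N ≤ H) (hNn : (N.subgroupOf H).Normal)
    (hNc : IsClosed (N : Set (SemiGraphs.GQp p))) (hNfg : IsTopologicallyFinitelyGenerated N)
    (hz : N ≠ ⊥ → ∃ z ∈ N, z ≠ 1 ∧ ∀ n ∈ N, n * z = z * n) : N = ⊥ :=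
  absoluteGaloisGroup_eq_bot_of_tfg_of_center p ℚ_[p] H N hHo hNH hNn hNc hNfg hz

end Instances

end Literature.AnabelianGeometry.AbsoluteAnabelian
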